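import Summits.ABC.IUTFork.Thm311Remarks
import Summits.ABC.IUTFork.Thm311LinkGlue
import Literature.IUT.HodgeTheaters.PolyIsoFunctoriality
import HarnessLib

/-!
# [IUTchIII] Theorem 3.11 in the author's terms, F2: Remark 3.11.1 (iii) (SHE) typed — its readings and their kernel status

Record-only file (D-0012) of the abc-iut cell (seat abc-iut-c312-1); TAKES NO SIDE. Sequel to `Thm311Remarks`
(F), which typed (IPL) (`LinkData.IPL`, `LinkData.ipl_iff_nonempty`) and left (SHE) NOTED ("kernel shadow
only"). The kernel DAG index of [IUTchIII] Cor. 3.12 (abc-iut-c312-2, `DAGC312q`: `derivable_xi_f_iff_SHE'`,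
`loci_census_v8`) carries (SHE) as the ONE opaque locus of 85 — a free `pending .SHE : Prop`. This file types
the locus at the level at which Theorem 3.11 is typed (files A–D), one declaration per reading, so that the
index can name a `Prop`, and records what the kernel then sees. Nothing here is a new fact; every `Prop` is a
definition over D's `LinkData` / B's `Situation`, and every theorem is bookkeeping.

## The text (read on the page; kurims May-2020 manuscript of [IUTchIII])

Rmk. 3.11.1 (iii), p. 161 l. 23–36: "(Simultaneous holomorphic expressibility (SHE)) The construction of
this output data, as well as the output data itself, is expressed in terms that are simultaneously
valid/executable/well-defined relative to both the arithmetic holomorphic structure that gives rise to the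
Θ-pilot object in the domain of the Θ-link … and the arithmetic holomorphic structure that gives rise to the
input data prime-strip [i.e., such as the `q`-pilot `F⊩▶×μ`-prime-strip, as discussed in (ii)] in the
codomain of the Θ-link". p. 161 l. 37–40: "In passing, we observe that this property "SHE" may be
understood, in a slightly more concrete way, as corresponding to the fact that the chain of (sub)quotients
considered in Remark 3.9.5, (viii), (ix), forms a closed loop."

Rmk. 3.9.5 (ix), p. 143 l. 24–43: "It is precisely by passing through (sQ3), (sQ4) — i.e., before applying
(sQ5)! … — that the chain of poly-isomorphisms of `F⊩▶×μ`-prime-strips [i.e., including the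
`F⊢×μ`-prime-strip portion of these `F⊩▶×μ`-prime-strips!] that · begins with the `F⊩▶×μ`-prime-strip arising
from the `q`-pilot object in the codomain of the `Θ×μ_LGP`-link, · passes through the `Θ×μ_LGP`-link to the
domain of the `Θ×μ_LGP`-link, · passes through the various poly-isomorphisms of `F⊩▶×μ`-prime-strips [cf. the
diagram of Remark 3.10.2 below; the discussion of "IPL" in Remark 3.11.1, (iii), below] induced by (sQ1),
(sQ2), and · finally, passes through (sQ3), (sQ4), which satisfy the compatibility property with the
log-Kummer correspondence discussed above [i.e., (cQ3), (cQ4)] forms a closed loop, i.e., up to the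
introduction of the "formal quotient indeterminacies" discussed in (cQ3), (cQ4)". p. 144 l. 14–19: "if one
attempts to skip either (sQ3) or (sQ4) and pass directly from (sQ2) to (sQ4) or (sQ5) [or from (sQ3) to
(sQ5)], then the resulting chain of poly-isomorphisms of `F⊩▶×μ`-prime-strips no longer forms a closed loop".
Rmk. 3.9.5 (viii), p. 139 l. 19–35: (sQ1) Kummer-detachment "cf. … the vertical arrows of the commutative
diagram of Remark 3.10.2", (sQ2) Galois evaluation "cf. … the horizontal arrows of the commutative diagram of
Remark 3.10.2", (sQ4) "adjusting the vertical shifts [i.e., in the vertical column of the log-theta-lattice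
corresponding to the codomain of the `Θ×μ_LGP`-link under consideration] in the output of the multiradial
algorithm by applying the log-Kummer correspondence". Rmk. 3.9.5 (ix), p. 142: (cQ4) "this adjustment
operation is tautologically compatible with suitable isomorphisms between the local Galois groups "`G_v`" and
the Frobenius-like units "`O^×μ_{F_v}`" …, so long as one allows for an indeterminacy with respect to
application of arbitrary iterates of the log-link"; (iQ5) "passing to log-volumes [i.e., (sQ5)] amounts
precisely to forgetting the local Galois groups and Frobenius-like units, i.e., the data that corresponds to
the `F⊢×μ`-prime-strip portion"; "(sQ3), (sQ4), (sQ5) all occur within the vertical column of the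
log-theta-lattice corresponding to the codomain of the `Θ×μ_LGP`-link".

## What is typed, and its status (neutral bookkeeping)

| reading of (SHE) | decl | kernel status |
|---|---|---|
| (SHE-loop) the closed loop of Rmk 3.9.5 (ix) at the level of D's `LinkData`, i.e. on the `F⊢×μ`-prime-strip portions the text insists on (p. 143 l. 26–27): codomain `^{n+1,m}F⊢×μ_△` → [link⁻¹] → `^{n,m}F⊢×μ_△` → [(sQ1) Kummer] → `F⊢×μ_△(^{n,∘}D⊢_△)` → [Prop 2.1 (vi)] → `F⊢×μ_env(^{n,∘}D_>)` → [étale-picture transport, full, (iii)(b)] → `F⊢×μ_env(^{n+1,∘}D_>)` → `F⊢×μ_△(^{n+1,∘}D⊢_△)` → [(sQ4) log-Kummer of the codomain column, any `m'`] → `^{n+1,m'}F⊢×μ_△` | `LinkData.sheLoop`, `LinkData.SHELoop` | `sheLoop_iff_ipl`: EQUIVALENT to (IPL) as typed; given (IPL) the loop is the FULL poly-isomorphism (`sheLoop_eq_full`) — it closes because the `Θ×μ_LGP`-link is a full poly-isomorphism (Def. 3.8 (ii); `LinkData.horizontal`), the mechanism of `ipl_iff_nonempty` / `partIIIa_holds`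 (LANA Rem. 8.2.1) |
| contrast: the same loop with RIGID gluing (one isomorphism for the link, one for the étale transport) | `LinkData.rigidLoop` | closes iff the Frobenius-like gluing equals the composite through the étale-like (Kummer) route (`refl_mem_rigidLoop_iff`); NOT automatic: `skew_rigidLoop_not_closed` (monodromy `−1` in L6-t3's witness groupoid); every rigid loop is a constituent of the (SHE)-loop (`rigidLoop_subset_sheLoop`) |
| (SHE-out) "the output data itself, is expressed … relative to both" structures: the output class `^{n,∘}R^{LGP}` computed in the domain line `n` and in the codomain line `n+1` coincide | `Situation.SHEOutput` | ⟺ Thm. 3.11 (i)'s `MultiradialCompat` (`sheOutput_iff_multiradialCompat`): already a clause of the typed `Statement` (`sheOutput_of_statement`) |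
| (SHE-strong) "complete the computation of the Θ-intertwining structure, up to suitable indeterminacies, on a `F⊩▶×μ`-prime-strip that is constrained to be subject to the `q`-intertwining" (p. 144 l. 1–3), read as: the codomain's `q`-pilot region is one of the possible images / lies in their hull | NOT re-typed here | = the readings of record BY NAME (`Cor312Vol.statement_of_qRegion_mem_possibleImages`, `…_of_qRegion_subset_thetaHull`; c312-1 `Thm311.Licence` in `Thm311ToCor312`) — typed, sufficient for Cor. 3.12, not automatic (Team A's gap witnesses): the residual the cell's adjudication block is about |
| Step (xi-e)'s gloss of (SHE) ("even when … the pilot-object log-volume … be equal to the fixed value", p. 183–184) | NOT here | Team A `Cor312.Setting.SheMeansFixedValueReal` (+ `_holds`), by name |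

So, for the index: `pending .SHE := S.SHETyped` (loop ∧ output) is discharged by name from exactly the two
hypotheses `derivable_xi_f_iff_SHE'` already carries (`sheTyped_of_statement_of_ipl hThm hIPL`); `pending
.SHE :=` the hypothesis of R3 is the reading under which the (xi-f) node carries the inequality. Which of
these the printed (SHE) "is" is the Step (xi) dispute itself; this file decides nothing about it. The
author's own caveat (APT) (Rmk. 3.11.1 (iv), p. 162 l. 17–24: "does not consist of a simple instance of
transport of some set-theoretic region … via some set-theoretic function. Rather, it consists of a
construction algorithm that is simultaneously valid/executable/well-defined with respect to the arithmetic
holomorphic structures in the domain and codomain") says (SHE) is a statement about the algorithm's TERMS OF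
EXPRESSION, which none of the set-level or groupoid-level readings above captures; recorded, not typed.

Sources read on the page: [IUTchIII] pp. 139–144 (Rmk. 3.9.5 (viii), (ix)), 151–152 (Rmk. 3.10.2), 160–162
(Rmk. 3.11.1 (ii)–(iv)), 183–184 (Step (xi-e)). [claim: Mochizuki2012, status: disputed]
[cite: LANA2026Report, Rem. 8.2.1 p. 42]
Deliberately NOT here: hulls / (sQ3) as operations on regions (abc-iut-L6-t4 `Literature.IUT.LogThetaLattice.
HolomorphicHull`: (sQ3) acts on regions, not on strips, and "determine[s] objects in the local and global
Frobenioids that appear in the codomain `F⊩▶×μ`-prime-strip" ((cQ3), p. 141) — no arrow at this level);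
log-volumes (sQ5); the Frobenioid-level `F⊩▶×μ`-prime-strips and the `gau`/`LGP`/`lgp` columns of the diagram
of Rmk. 3.10.2 (campaign M; D's `LinkData` carries the `△`/`env` strips only); any judgement.
-/

noncomputable section

namespace Summit.ABC

namespace IUTFork

namespace Thm311

open CategoryTheory
open Literature.IUT.HodgeTheaters (PolyIso)

/-! ## 0. Two poly-isomorphism lemmas ([IUTchI] §0 calculus; bookkeeping) -/

namespace PolyIsoCalc

universe v u

variable {C : Type u} [Category.{v} C] {X Y Z : C}

/-- The composite of nonempty poly-isomorphisms is nonempty. [folklore] -/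
theorem nonempty_comp {P : PolyIso X Y} {Q : PolyIso Y Z} (hP : P.Nonempty) (hQ : Q.Nonempty) :
    (PolyIso.comp P Q).Nonempty := by
  obtain ⟨f, hf⟩ := hP
  obtain ⟨g, hg⟩ := hQ
  exact ⟨f ≪≫ g, PolyIso.mem_comp.2 ⟨f, hf, g, hg, rfl⟩⟩

/-- The composite of two single isomorphisms is the single composite. [folklore] -/
theorem single_comp_single (f : X ≅ Y) (g : Y ≅ Z) :
    PolyIso.comp (PolyIso.single f) (PolyIso.single g) = PolyIso.single (f ≪≫ g) := by
  ext h
  simp only [PolyIso.mem_comp, PolyIso.mem_single, exists_eq_left]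
  exact eq_comm

/-- Composition of poly-isomorphisms is monotone in both arguments. [folklore] -/
theorem comp_subset_comp {P P' : PolyIso X Y} {Q Q' : PolyIso Y Z} (hP : P ⊆ P') (hQ : Q ⊆ Q') :
    PolyIso.comp P Q ⊆ PolyIso.comp P' Q' := by
  intro h hh
  obtain ⟨f, hf, g, hg, rfl⟩ := PolyIso.mem_comp.1 hh
  exact PolyIso.mem_comp.2 ⟨f, hP hf, g, hQ hg, rfl⟩

end PolyIsoCalc

namespace LinkData

variable (K : LinkData)

/-! ## 1. (SHE-loop): the chain of Rmk 3.9.5 (ix) at the level of `LinkData` -/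

/-- **The chain of (sub)quotients of Rmk. 3.9.5 (viii), (ix), at the level of the `F⊢×μ`-prime-strip
portions** (p. 143 l. 24–43), for the horizontal arrow `(n,m) → (n+1,m)` and a vertical coordinate `m'` of
the codomain column: it "begins with the `F⊩▶×μ`-prime-strip arising from the `q`-pilot object in the
codomain" (`^{n+1,m}F⊢×μ_△`), "passes through the `Θ×μ_LGP`-link to the domain" (the inverse of the full
poly-isomorphism `K.horizontal n m`, Def. 3.8 (ii) / Thm. 1.5 (ii)), "passes through the various
poly-isomorphisms of `F⊩▶×μ`-prime-strips [cf. the diagram of Remark 3.10.2 …; … "IPL" …] induced by (sQ1),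
(sQ2)" — (sQ1) Kummer-detachment = the first vertical arrow of Rmk. 3.10.2 (`K.kumDelta n m`), then the
natural isomorphism to the `env`-strip of the diagram's upper row (`K.natEnvD n`, Prop. 2.1 (vi)), then the
étale-picture transport to the codomain line, "the full poly-isomorphism `F⊢×μ_env(^{n,∘}D_>) ⥲
F⊢×μ_env(^{n+1,∘}D_>)`" of Thm. 3.11 (iii) (b) — "and finally, passes through … (sQ4)": "adjusting the
vertical shifts … in the vertical column … corresponding to the codomain … by applying the log-Kummer
correspondence" (`(K.natEnvD (n+1))⁻¹`, `(K.kumDelta (n+1) m')⁻¹`, any `m'` — (cQ4): "so long as one allows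
for an indeterminacy with respect to application of arbitrary iterates of the log-link"). (sQ3) (hulls)
changes regions, not strips ((cQ3): the hulls "determine objects in the local and global Frobenioids that
appear in the codomain `F⊩▶×μ`-prime-strip"), so it contributes no arrow at this level.
[claim: Mochizuki2012, status: disputed] -/
@[claim "Mochizuki2012" "disputed"]
def sheLoop (n m m' : ℤ) : PolyIso (K.Fdelta (n + 1) m) (K.Fdelta (n + 1) m') :=
  PolyIso.comp (K.horizontal n m).symm
    (PolyIso.comp (PolyIso.single (K.kumDelta n m))
      (PolyIso.comp (PolyIso.single (K.natEnvD n))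
        (PolyIso.comp (PolyIso.full (K.FenvD n) (K.FenvD (n + 1)))
          (PolyIso.comp (PolyIso.single (K.natEnvD (n + 1)).symm)
            (PolyIso.single (K.kumDelta (n + 1) m').symm)))))

/-- **(SHE), closed-loop reading** (Rmk. 3.11.1 (iii), p. 161 l. 37–40: "this property "SHE" may be
understood … as corresponding to the fact that the chain of (sub)quotients considered in Remark 3.9.5,
(viii), (ix), forms a closed loop"; Rmk. 3.9.5 (ix), p. 143 l. 41–43: "forms a closed loop, i.e., up to the
introduction of the "formal quotient indeterminacies""). READING at the level of `LinkData`: for every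
horizontal arrow the chain `sheLoop n m m`, which starts and ends at the codomain's `^{n+1,m}F⊢×μ_△`, closes —
the identity is one of its constituent isomorphisms (the poly-isomorphism formalism retaining all the others
as the indeterminacy). [claim: Mochizuki2012, status: disputed] -/
@[claim "Mochizuki2012" "disputed"]
def SHELoop : Prop := ∀ n m : ℤ, Iso.refl _ ∈ K.sheLoop n m m

variable {K}

/-- An isomorphism of the Frobenius-like strips across the horizontal arrow induces one of the étale-like
`env`-strips of the two lines (through the Kummer and natural isomorphisms). [folklore] -/
def envIsoOfStripIso {n m : ℤ} (e : K.Fdelta n m ≅ K.Fdelta (n + 1) m) : K.FenvD n ≅ K.FenvD (n + 1) :=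
  (K.natEnvD n).symm ≪≫ (K.kumDelta n m).symm ≪≫ e ≪≫ K.kumDelta (n + 1) m ≪≫ K.natEnvD (n + 1)

/-- Given ONE isomorphism across the horizontal arrow `(n,m) → (n+1,m)` (i.e. (IPL) there), the chain of
Rmk. 3.9.5 (ix) is the FULL poly-isomorphism `^{n+1,m}F⊢×μ_△ ⥲ ^{n+1,m'}F⊢×μ_△`: it passes through the
`Θ×μ_LGP`-link, a full poly-isomorphism, and a composite with a full poly-isomorphism is full ([IUTchI] §0;
`PolyIso.full_comp_of_nonempty`). [folklore] -/
theorem sheLoop_eq_full {n m : ℤ} (h : (K.horizontal n m).Nonempty) (m' : ℤ) :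
    K.sheLoop n m m' = PolyIso.full _ _ := by
  obtain ⟨e, -⟩ := h
  have hτ : (PolyIso.full (K.FenvD n) (K.FenvD (n + 1))).Nonempty := ⟨envIsoOfStripIso e, PolyIso.mem_full _⟩
  have htail : (PolyIso.comp (PolyIso.single (K.kumDelta n m))
      (PolyIso.comp (PolyIso.single (K.natEnvD n))
        (PolyIso.comp (PolyIso.full (K.FenvD n) (K.FenvD (n + 1)))
          (PolyIso.comp (PolyIso.single (K.natEnvD (n + 1)).symm)
            (PolyIso.single (K.kumDelta (n + 1) m').symm))))).Nonempty :=
    PolyIsoCalc.nonempty_comp ⟨_, rfl⟩ (PolyIsoCalc.nonempty_comp ⟨_, rfl⟩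
      (PolyIsoCalc.nonempty_comp hτ (PolyIsoCalc.nonempty_comp ⟨_, rfl⟩ ⟨_, rfl⟩)))
  show PolyIso.comp (PolyIso.full _ _).symm _ = _
  rw [PolyIso.symm_full, PolyIso.full_comp_of_nonempty htail]

/-- Under (IPL) the chain relates the codomain's `q`-pilot strip to EVERY `^{n+1,m'}F⊢×μ_△` of the codomain
column (the vertical-shift indeterminacy of (sQ4)/(cQ4), p. 142): it is nonempty for all `m'`. [folklore] -/
theorem sheLoop_nonempty (h : K.IPL) (n m m' : ℤ) : (K.sheLoop n m m').Nonempty := by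
  rw [sheLoop_eq_full (h n m)]
  exact ⟨K.kumDelta (n + 1) m ≪≫ (K.kumDelta (n + 1) m').symm, PolyIso.mem_full _⟩

/-- If the chain at `(n,m)` has any constituent at all, the horizontal arrow there is a nonempty
poly-isomorphism (its first step is the inverse of that arrow). [folklore] -/
theorem horizontal_nonempty_of_sheLoop_nonempty {n m m' : ℤ} (h : (K.sheLoop n m m').Nonempty) :
    (K.horizontal n m).Nonempty := by
  obtain ⟨g, hg⟩ := h
  obtain ⟨f, hf, -, -, -⟩ := PolyIso.mem_comp.1 hg
  obtain ⟨f₀, hf₀, -⟩ := hf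
  exact ⟨f₀, hf₀⟩

variable (K)

/-- **(SHE) in the closed-loop reading, typed at the level of `LinkData`, is EQUIVALENT to (IPL) as typed**
(`LinkData.IPL`: consecutive strips are linked by a nonempty full poly-isomorphism; `ipl_iff_nonempty`: they
are abstractly isomorphic). Both directions are bookkeeping: the loop begins with the inverse of the link, and
a loop through a full poly-isomorphism is full. Cf. LANA Rem. 8.2.1 (p. 42) on (IPL)/(SHE): "the assertion
that two BPSs are "linked," in the sense that there exists an isomorphism between them, is a vacuous assertion
since the category of BPSs is a connected groupoid". [cite: LANA2026Report, Rem. 8.2.1 p. 42] -/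
theorem sheLoop_iff_ipl : K.SHELoop ↔ K.IPL := by
  constructor
  · intro h n m
    exact horizontal_nonempty_of_sheLoop_nonempty ⟨_, h n m⟩
  · intro h n m
    rw [sheLoop_eq_full (h n m)]
    exact PolyIso.mem_full _

/-- (SHE)-loop holds as soon as the category of strips is connected — as the tree's prime-strip categories
are by construction (`Thm311Remarks`: `ipl_of_connected`). [folklore] -/
theorem sheLoop_of_connected (h : ∀ X Y : K.Strip, Nonempty (X ≅ Y)) : K.SHELoop :=
  K.sheLoop_iff_ipl.2 (K.ipl_of_connected h)

/-! ## 2. Contrast: the same chain with rigid gluing (where a loop can fail to close) -/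

/-- The chain of Rmk. 3.9.5 (ix) with the two full poly-isomorphisms replaced by SINGLE isomorphisms: a
rigid gluing `lam : ^{n,m}F⊢×μ_△ ⥲ ^{n+1,m}F⊢×μ_△` in place of the `Θ×μ_LGP`-link ("forced identification of
arithmetic holomorphic structures", Rmk. 3.11.1 (vii)) and a rigid étale transport `tau` in place of the
étale-picture full poly-isomorphism. [folklore] -/
def rigidLoop {n m : ℤ} (lam : K.Fdelta n m ≅ K.Fdelta (n + 1) m) (tau : K.FenvD n ≅ K.FenvD (n + 1))
    (m' : ℤ) : PolyIso (K.Fdelta (n + 1) m) (K.Fdelta (n + 1) m') :=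
  PolyIso.comp (PolyIso.single lam.symm)
    (PolyIso.comp (PolyIso.single (K.kumDelta n m))
      (PolyIso.comp (PolyIso.single (K.natEnvD n))
        (PolyIso.comp (PolyIso.single tau)
          (PolyIso.comp (PolyIso.single (K.natEnvD (n + 1)).symm)
            (PolyIso.single (K.kumDelta (n + 1) m').symm)))))

variable {K}

/-- The gluing `^{n,m}F⊢×μ_△ ⥲ ^{n+1,m}F⊢×μ_△` induced through the étale-like route: Kummer-detach at `(n,m)`,
transport the `env`-strip by `tau`, re-attach by the log-Kummer correspondence of the codomain column at
`(n+1,m)`. [folklore] -/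
def etaleRouteIso {n : ℤ} (m : ℤ) (tau : K.FenvD n ≅ K.FenvD (n + 1)) : K.Fdelta n m ≅ K.Fdelta (n + 1) m :=
  K.kumDelta n m ≪≫ K.natEnvD n ≪≫ tau ≪≫ (K.natEnvD (n + 1)).symm ≪≫ (K.kumDelta (n + 1) m).symm

/-- A rigid loop is the single isomorphism `lam⁻¹` followed by the étale route. [folklore] -/
theorem rigidLoop_eq_single {n m : ℤ} (lam : K.Fdelta n m ≅ K.Fdelta (n + 1) m)
    (tau : K.FenvD n ≅ K.FenvD (n + 1)) :
    K.rigidLoop lam tau m = PolyIso.single (lam.symm ≪≫ etaleRouteIso m tau) := by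
  simp only [rigidLoop, etaleRouteIso, PolyIsoCalc.single_comp_single]

/-- **A rigid loop closes iff the Frobenius-like gluing IS the gluing induced through the étale-like
(Kummer) route.** This is where a loop can carry content: with specific isomorphisms the composite around the
loop is a possibly non-trivial automorphism of the codomain's strip. [folklore] -/
theorem refl_mem_rigidLoop_iff {n m : ℤ} (lam : K.Fdelta n m ≅ K.Fdelta (n + 1) m)
    (tau : K.FenvD n ≅ K.FenvD (n + 1)) :
    Iso.refl _ ∈ K.rigidLoop lam tau m ↔ lam = etaleRouteIso m tau := by
  rw [rigidLoop_eq_single, PolyIso.mem_single]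
  constructor
  · intro h
    have h' := congrArg (fun g => lam ≪≫ g) h
    simpa using h'
  · rintro rfl
    simp

/-- The rigid loop of the étale-route gluing itself closes. [folklore] -/
theorem refl_mem_rigidLoop_etaleRoute {n : ℤ} (m : ℤ) (tau : K.FenvD n ≅ K.FenvD (n + 1)) :
    Iso.refl _ ∈ K.rigidLoop (etaleRouteIso m tau) tau m :=
  (refl_mem_rigidLoop_iff _ _).2 rfl

/-- Every rigid loop is a constituent of the (SHE)-loop (single isomorphisms lie in the full
poly-isomorphisms they replace): the poly-isomorphism formalism closes the loop by retaining ALL rigid loops at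
once. [folklore] -/
theorem rigidLoop_subset_sheLoop {n m : ℤ} (lam : K.Fdelta n m ≅ K.Fdelta (n + 1) m)
    (tau : K.FenvD n ≅ K.FenvD (n + 1)) (m' : ℤ) : K.rigidLoop lam tau m' ⊆ K.sheLoop n m m' := by
  refine PolyIsoCalc.comp_subset_comp (fun f _ => ?_) (PolyIsoCalc.comp_subset_comp subset_rfl
    (PolyIsoCalc.comp_subset_comp subset_rfl (PolyIsoCalc.comp_subset_comp (fun _ _ => PolyIso.mem_full _)
      subset_rfl)))
  exact ⟨f.symm, PolyIso.mem_full _, f.symm_symm_eq⟩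

open Literature.IUT.LogThetaLattice in
/-- **Non-closure witness.** Over the link data `Checks.skewLink` (`Thm311LinkGlue` §4c: all strips the one
object of L6-t3's witness groupoid `Witness.Pt = SingleObj ℤˣ`, all structural isomorphisms the identity), glue
rigidly by `−1` (`Witness.negIso`) and transport by the identity: the loop is `{−1}` and does NOT close
(`Witness.negIso_ne_refl`). [folklore] -/
theorem skew_rigidLoop_not_closed :
    Iso.refl _ ∉ Checks.skewLink.rigidLoop (n := 0) (m := 0) Witness.negIso (Iso.refl _) 0 := by
  rw [refl_mem_rigidLoop_iff]
  intro h
  apply Witness.negIso_ne_refl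
  rw [h]
  rfl

/-- Hence closure of a RIGID loop is independent of the signature: it holds for the étale-route gluing and
fails for the skew gluing — in contrast with the (SHE)-loop, which closes for every link datum satisfying
(IPL) (`sheLoop_iff_ipl`). [folklore] -/
theorem rigidLoop_closure_independent :
    (∃ (K : LinkData) (lam : K.Fdelta 0 0 ≅ K.Fdelta (0 + 1) 0) (tau : K.FenvD 0 ≅ K.FenvD (0 + 1)),
        Iso.refl _ ∈ K.rigidLoop lam tau 0) ∧
      ∃ (K : LinkData) (lam : K.Fdelta 0 0 ≅ K.Fdelta (0 + 1) 0) (tau : K.FenvD 0 ≅ K.FenvD (0 + 1)),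
        Iso.refl _ ∉ K.rigidLoop lam tau 0 :=
  ⟨⟨Checks.skewLink, etaleRouteIso 0 (Iso.refl _), Iso.refl _, refl_mem_rigidLoop_etaleRoute 0 _⟩,
    ⟨Checks.skewLink, _, _, skew_rigidLoop_not_closed⟩⟩

end LinkData

/-! ## 3. (SHE-out): the output class does not depend on which line computed it -/

namespace Situation

variable {T : ThetaIndex} (S : Situation T)

/-- **(SHE), output reading** (Rmk. 3.11.1 (iii), p. 161 l. 23–24: "The construction of this output data,
as well as the output data itself, is expressed in terms that are simultaneously valid … relative to both"
the domain's and the codomain's arithmetic holomorphic structures; the output being "a representation of the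
data of Theorem 3.11, (i), (b), (c) …, up to certain mild indeterminacies on the mono-analytic étale-like
log-shells", p. 160 l. 26–29). READING at the level of B's `Situation` (all lines' data on the one coric
`LogShells`): for every `Θ×μ_LGP`-link `(n,·) → (n+1,·)` the output class `^{n,∘}R^{LGP}` computed from the
domain line and `^{n+1,∘}R^{LGP}` computed from the codomain line are the same class.
[claim: Mochizuki2012, status: disputed] -/
@[claim "Mochizuki2012" "disputed"]
def SHEOutput : Prop := ∀ n : ℤ, S.RLGP (n + 1) = S.RLGP n

/-- **(SHE-out) is Theorem 3.11 (i)'s multiradial compatibility** (`MultiradialCompat : ∀ n n',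
^{n,∘}R^{LGP} = ^{n',∘}R^{LGP}`): adjacent equalities propagate along `ℤ`. So this reading is already a clause
of the typed Theorem 3.11 and adds nothing to it. [folklore] -/
theorem sheOutput_iff_multiradialCompat : S.SHEOutput ↔ S.MultiradialCompat := by
  constructor
  · intro h
    have h0 : ∀ n : ℤ, S.RLGP n = S.RLGP 0 := by
      intro n
      induction n using Int.induction_on with
      | zero => rfl
      | succ k ih => rw [h k, ih]
      | pred k ih =>
        have hk := h (-(k : ℤ) - 1)
        rw [sub_add_cancel] at hk
        rw [← hk, ih]
    intro n n'
    rw [h0 n, h0 n']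
  · intro h n
    exact h (n + 1) n

end Situation

namespace FullSituation

variable {T : ThetaIndex} (S : FullSituation T)

/-- (SHE-out) follows from Theorem 3.11 as typed (it is (i)'s multiradial compatibility). [folklore] -/
theorem sheOutput_of_statement (h : S.Statement) : S.toSituation.SHEOutput :=
  S.toSituation.sheOutput_iff_multiradialCompat.2 h.1.2.2

/-- **(SHE) typed at the level of Theorem 3.11 as typed**: the closed loop of Rmk. 3.9.5 (ix) on the
`F⊢×μ`-prime-strip portions (`LinkData.SHELoop`) together with the output reading (`Situation.SHEOutput`) —
the `Prop` offered to the kernel DAG index for its locus (SHE). The STRONGER reading the Step (xi-f)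
inference needs (the codomain's `q`-pilot region among the possible images) is the reading of record R3, by
name, and is NOT part of this `Prop`. [claim: Mochizuki2012, status: disputed] -/
@[claim "Mochizuki2012" "disputed"]
def SHETyped : Prop := S.link.SHELoop ∧ S.toSituation.SHEOutput

/-- **(SHE) so typed is discharged by Theorem 3.11 as typed + (IPL)** — exactly the two hypotheses the
index's `derivable_xi_f_iff_SHE'` already carries. Bookkeeping; no side taken on what the printed (SHE)
asserts beyond this level. [folklore] -/
theorem sheTyped_of_statement_of_ipl (hS : S.Statement) (hIPL : S.link.IPL) : S.SHETyped :=
  ⟨S.link.sheLoop_iff_ipl.2 hIPL, S.sheOutput_of_statement hS⟩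

/-- Conversely (SHE) so typed gives back (IPL) and (i)'s multiradial compatibility: at this level the locus
is equivalent to `IPL ∧ MultiradialCompat`. [folklore] -/
theorem sheTyped_iff : S.SHETyped ↔ S.link.IPL ∧ S.MultiradialCompat := by
  unfold SHETyped
  rw [S.link.sheLoop_iff_ipl, S.toSituation.sheOutput_iff_multiradialCompat]

end FullSituation

end Thm311

end IUTFork

end Summit.ABC

end
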